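import Literature.Analysis.FluidPDE.TaoAveragedJointWeightDataAt
import HarnessLib

/-!
# Tao 2016, §3.5–§3.9 about a FRAME TRIPLE: the rotation average with a smooth joint weight
# reproduces the product of the profile pairings — proof, with the base triangle as a parameter

T. Tao, *Finite time blowup for an averaged three-dimensional Navier–Stokes equation*,
J. Amer. Math. Soc. **29** (2016), 601–674 = arXiv:1402.0290v3, §3.5–3.9 pp. 17–20, Remark 3.5 p. 20.
HONEST FRAMING (cell harvest/h2-tao-ladder, TAO-LADDER rung `M_1` — MODEL statements about Tao's
averaged equation; nothing here concerns the true Navier–Stokes equations): this file is the tree's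
`TaoAveragedJointWeightProofs.lean` (the discharge `rotationAverage_jointWeight_holds` of §3.6–3.9 at
Tao's normalisation (3.7)) RE-RUN WITH THE BASE TRIPLE AS A PARAMETER, for base triples `ξ` in frame
position (`IsFrameTriple`) under the non-degeneracy (3.24) within a radius `δ > 5500 ε₀³`
(`NondegWithin ξ δ`), with the data `(4, jointMeasure, jointE, jointFAt ξ ψ)` of
`TaoAveragedJointWeightDataAt.lean` and Tao's single-scale weight `φ η_ξ` of `B_{η,ρ,0;ξ}`
(`singleScaleWeightAtC`, `jointWeightAverageW`). Chain of the proof (as in the tree):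
a.e.-representatives; Fubini; the fibre step (torus average over the angles, Fourier extraction on
`(ℝ/2πℤ)³`, fibre synthesis (3.20)–(3.21) non-degenerate by (3.24), `φ η_ξ ≡ 1` on the support);
the rotation disintegration (§3.6) and the normalisation of the density; factorisation; `χⱼ = 1` on
`supp ψ̂ⱼ` and `Xⱼ · P aⱼ = Xⱼ · aⱼ` for divergence-free `Xⱼ`. Main results:
`jointWeightAverageW_eq_at` and the packaged **`jointWeight_identity_frameTriple`** (the joint-weight
data `(d, μ₀, E, F)` about every gapped frame triple, `ε₀ ≤ min 10⁻⁴ …`), which is the hypothesis of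
`singleScaleAt_isComplexAverageNoDil_of_jointWeightAt` (§3.5–3.6) — i.e. Theorem 3.2's single-scale
step (3.9) without dilation averaging about the frame triple.

## References

* T. Tao, J. Amer. Math. Soc. 29 (2016), 601–674, arXiv:1402.0290v3, §3.5–3.9 pp. 17–20, Remark 3.5
  p. 20. Key `Tao2016AveragedNS`.
-/

noncomputable section

open Real MeasureTheory Quaternion Set FourierTransform intervalIntegral
open scoped RealInnerProductSpace Quaternion ENNReal ComplexConjugate SchwartzMap

namespace Literature.Analysis.FluidPDE.Tao2016

open FunctionSpaces.EuclideanSpace (complexify complexify_apply)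

attribute [local instance] quatMeasurableSpace quatBorelSpace

variable {ξ : Fin 3 → EuclideanSpace ℝ (Fin 3)} {ε₀ δ : ℝ} {ψ : Fin 3 → 𝓢(EuclideanSpace ℝ (Fin 3), EuclideanSpace ℂ (Fin 3))}
  {X : Fin 3 → EuclideanSpace ℝ (Fin 3) → EuclideanSpace ℂ (Fin 3)}

/-- **The rotation average (general weight) depends on the `Xⱼ` only up to null sets.** [cite: Tao2016AveragedNS, §3.6 (3.15)–(3.16) p. 18] -/
theorem jointWeightAverageW_congr_ae {V : Type*} [MeasurableSpace V] (μ₀ : Measure V)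
    (E : Fin 3 → V → (EuclideanSpace ℝ (Fin 3) ≃ₗᵢ[ℝ] EuclideanSpace ℝ (Fin 3))) (w : EuclideanSpace ℝ (Fin 3) × EuclideanSpace ℝ (Fin 3) → ℂ)
    (F : V × (EuclideanSpace ℝ (Fin 3) × EuclideanSpace ℝ (Fin 3)) → ℂ) {X₁ X₁' X₂ X₂' X₃ X₃' : EuclideanSpace ℝ (Fin 3) → EuclideanSpace ℂ (Fin 3)}
    (h₁ : X₁ =ᵐ[volume] X₁') (h₂ : X₂ =ᵐ[volume] X₂') (h₃ : X₃ =ᵐ[volume] X₃') :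
    jointWeightAverageW μ₀ E w F X₁ X₂ X₃ = jointWeightAverageW μ₀ E w F X₁' X₂' X₃' := by
  unfold jointWeightAverageW
  refine integral_congr_ae (Filter.Eventually.of_forall fun w => ?_)
  refine integral_congr_ae ?_
  filter_upwards [ae_comp_isometry_fst h₁ (E 0 w).symm, ae_comp_isometry_snd h₂ (E 1 w).symm,
    ae_comp_isometry_neg h₃ (E 2 w).symm] with p hp1 hp2 hp3
  simp only [hp1, hp2, hp3]

/-- **One slot of the final product**: for `ψ̂` supported in `B̄(ξⱼ⁰, ε₀³)` and divergence-free
`X`, `∫ χⱼ(ζ) X(ζ)·P_ζ\overline{ψ̂(ζ)} dζ = ∫ X(ζ)·\overline{ψ̂(ζ)} dζ`. [cite: Tao2016AveragedNS, §3.5–3.6 pp. 17–18] -/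
theorem slot_integral_eq_at (hε : 0 < ε₀) {φ : 𝓢(EuclideanSpace ℝ (Fin 3), EuclideanSpace ℂ (Fin 3))} {j : Fin 3} (hφ : HasBallFourierSupport (ξ j) (ε₀ ^ 3) φ)
    {X : EuclideanSpace ℝ (Fin 3) → EuclideanSpace ℂ (Fin 3)} (hd : FreqDivFree X) :
    ∫ ζ, (((zetaBumpAt ξ hε j) ζ : ℝ) : ℂ) * cdot (X ζ) (projPerp ζ (conj3 (𝓕 (⇑φ) ζ))) =
      ∫ ζ, cdot (X ζ) (conj3 (𝓕 (⇑φ) ζ)) := by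
  refine integral_congr_ae ?_
  filter_upwards [hd] with ζ hζ
  by_cases h0 : 𝓕 (⇑φ) ζ = 0
  · rw [h0, map_zero, projPerp_zero, cdot_zero_right', mul_zero]
  · have hdist : dist ζ (ξ j) ≤ ε₀ ^ 3 := by
      by_contra hlt
      exact h0 (hφ ζ (not_le.mp hlt))
    have h1 : (zetaBumpAt ξ hε j) ζ = 1 := (zetaBumpAt ξ hε j).one_of_mem_closedBall (by
      rw [Metric.mem_closedBall]; exact hdist)
    rw [h1, cdot_projPerp_of_divFree hζ]
    push_cast
    ring

/-- `0 ≤ zCut3At ≤ 1`. [cite: Tao2016AveragedNS, §3.6 p. 18] -/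
theorem zCut3At_nonneg_le_one (hε : 0 < ε₀) (ζ : EuclideanSpace ℝ (Fin 3) × EuclideanSpace ℝ (Fin 3) × EuclideanSpace ℝ (Fin 3)) : 0 ≤ zCut3At ξ hε ζ ∧ zCut3At ξ hε ζ ≤ 1 :=
  ⟨mul_nonneg (mul_nonneg (zetaBumpAt ξ hε 0).nonneg (zetaBumpAt ξ hε 1).nonneg) (zetaBumpAt ξ hε 2).nonneg,
    mul_le_one₀ (mul_le_one₀ (zetaBumpAt ξ hε 0).le_one (zetaBumpAt ξ hε 1).nonneg (zetaBumpAt ξ hε 1).le_one)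
      (zetaBumpAt ξ hε 2).nonneg (zetaBumpAt ξ hε 2).le_one⟩

/-- `zCut3At` is continuous. [cite: Tao2016AveragedNS, §3.6 p. 18] -/
theorem continuous_zCut3At (hε : 0 < ε₀) : Continuous (zCut3At ξ hε) := by
  unfold zCut3At
  exact (((zetaBumpAt ξ hε 0).continuous.comp continuous_fst).mul
    ((zetaBumpAt ξ hε 1).continuous.comp (continuous_fst.comp continuous_snd))).mul
    ((zetaBumpAt ξ hε 2).continuous.comp (continuous_snd.comp continuous_snd))

/-- On the support of `zCut3At` all three frequencies are within `2ε₀³` of the base. [cite: Tao2016AveragedNS, §3.6 p. 18] -/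
theorem near_of_zCut3At_ne_zero (hε : 0 < ε₀) {ζ : EuclideanSpace ℝ (Fin 3) × EuclideanSpace ℝ (Fin 3) × EuclideanSpace ℝ (Fin 3)} (h : zCut3At ξ hε ζ ≠ 0) :
    dist ζ.1 (ξ 0) < 2 * ε₀ ^ 3 ∧ dist ζ.2.1 (ξ 1) < 2 * ε₀ ^ 3 ∧ dist ζ.2.2 (ξ 2) < 2 * ε₀ ^ 3 := by
  unfold zCut3At at h
  simp only [mul_ne_zero_iff] at h
  obtain ⟨⟨h0, h1⟩, h2⟩ := h
  exact ⟨bump_dist_lt_of_ne_zero _ h0, bump_dist_lt_of_ne_zero _ h1, bump_dist_lt_of_ne_zero _ h2⟩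

/-- **The triangle weight of the magnitude cut-off about `ξ` is at most `1`.** [cite: Tao2016AveragedNS, §3.6 p. 18] -/
theorem triWeight_RweightAt_le_one (hε : 0 < ε₀) (ζ : EuclideanSpace ℝ (Fin 3) × EuclideanSpace ℝ (Fin 3) × EuclideanSpace ℝ (Fin 3)) : triWeight (RweightAt ξ hε) ζ ≤ 1 := by
  unfold triWeight RweightAt
  have hind : (Ioo |‖ζ.2.2‖ - ‖ζ.1‖| (‖ζ.2.2‖ + ‖ζ.1‖)).indicator (fun _ => (1 : ℝ≥0∞)) ‖ζ.2.1‖ ≤ 1 := by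
    by_cases h : ‖ζ.2.1‖ ∈ Ioo |‖ζ.2.2‖ - ‖ζ.1‖| (‖ζ.2.2‖ + ‖ζ.1‖)
    · rw [indicator_of_mem h]
    · rw [indicator_of_notMem h]; exact zero_le_one
  set r := ‖ζ.1‖ * ‖ζ.2.1‖ * ‖ζ.2.2‖ with hr
  set κ := (kappaBumpAt ξ hε 0) ‖ζ.1‖ * (kappaBumpAt ξ hε 1) ‖ζ.2.1‖ * (kappaBumpAt ξ hε 2) ‖ζ.2.2‖ with hκ
  have hκ0 : 0 ≤ κ := mul_nonneg (mul_nonneg (kappaBumpAt ξ hε 0).nonneg (kappaBumpAt ξ hε 1).nonneg) (kappaBumpAt ξ hε 2).nonneg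
  have hκ1 : κ ≤ 1 := mul_le_one₀ (mul_le_one₀ (kappaBumpAt ξ hε 0).le_one (kappaBumpAt ξ hε 1).nonneg (kappaBumpAt ξ hε 1).le_one)
    (kappaBumpAt ξ hε 2).nonneg (kappaBumpAt ξ hε 2).le_one
  have hr0 : 0 ≤ r := by positivity
  have h2 : ENNReal.ofReal (r * κ) * ENNReal.ofReal r⁻¹ ≤ 1 := by
    rw [← ENNReal.ofReal_mul (by positivity)]
    refine ENNReal.ofReal_le_one.mpr ?_
    by_cases hr' : r = 0
    · rw [hr', zero_mul, zero_mul]; exact zero_le_one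
    · rw [mul_comm, ← mul_assoc, inv_mul_cancel₀ hr', one_mul]; exact hκ1
  calc _ ≤ 1 * (ENNReal.ofReal (r * κ) * ENNReal.ofReal r⁻¹) := by rw [mul_assoc]; gcongr
    _ ≤ 1 * 1 := by gcongr
    _ = 1 := one_mul 1

/-- **The triangle weight is `1` near a frame triple** (`ε₀ ≤ 1/10`): there the magnitude cut-offs are
`1` and the three magnitudes satisfy the strict triangle inequalities (window slack `1/10`). [cite: Tao2016AveragedNS, §3.6 p. 18] -/
theorem triWeight_RweightAt_eq_one (hξ : IsFrameTriple ξ) (hε : 0 < ε₀) (hε1 : ε₀ ≤ 1 / 10)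
    {ζ : EuclideanSpace ℝ (Fin 3) × EuclideanSpace ℝ (Fin 3) × EuclideanSpace ℝ (Fin 3)}
    (h0 : dist ζ.1 (ξ 0) < 2 * ε₀ ^ 3) (h1 : dist ζ.2.1 (ξ 1) < 2 * ε₀ ^ 3) (h2 : dist ζ.2.2 (ξ 2) < 2 * ε₀ ^ 3) :
    triWeight (RweightAt ξ hε) ζ = 1 := by
  have ht0 : 0 < ε₀ ^ 3 := eps_cube_pos hε
  have ht1 : ε₀ ^ 3 ≤ 1 / 1000 := by
    calc ε₀ ^ 3 ≤ (1 / 10) ^ 3 := by gcongr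
      _ = 1 / 1000 := by norm_num
  -- radii
  have hr : ∀ {v c : EuclideanSpace ℝ (Fin 3)}, dist v c < 2 * ε₀ ^ 3 → |‖v‖ - ‖c‖| < 2 * ε₀ ^ 3 := fun {v c} h =>
    lt_of_le_of_lt (abs_norm_sub_norm_le v c) (by rwa [dist_eq_norm] at h)
  have hr0 := hr h0; have hr1 := hr h1; have hr2 := hr h2
  obtain ⟨a0, b0⟩ := abs_lt.mp hr0
  obtain ⟨a1, b1⟩ := abs_lt.mp hr1
  obtain ⟨a2, b2⟩ := abs_lt.mp hr2
  obtain ⟨wa1, wa2⟩ := hξ.window 0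
  obtain ⟨wb1, wb2⟩ := hξ.window 1
  obtain ⟨wc1, wc2⟩ := hξ.window 2
  have hk : ∀ (j : Fin 3) {r : ℝ}, |r - ‖ξ j‖| < 2 * ε₀ ^ 3 → (kappaBumpAt ξ hε j) r = 1 := fun j {r} h =>
    (kappaBumpAt ξ hε j).one_of_mem_closedBall (by rw [Metric.mem_closedBall, Real.dist_eq, kappaBumpAt_rIn ξ]; exact h.le)
  have k0 : (kappaBumpAt ξ hε 0) ‖ζ.1‖ = 1 := hk 0 hr0
  have k1 : (kappaBumpAt ξ hε 1) ‖ζ.2.1‖ = 1 := hk 1 hr1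
  have k2 : (kappaBumpAt ξ hε 2) ‖ζ.2.2‖ = 1 := hk 2 hr2
  have hmem : ‖ζ.2.1‖ ∈ Ioo |‖ζ.2.2‖ - ‖ζ.1‖| (‖ζ.2.2‖ + ‖ζ.1‖) := by
    constructor
    · rw [abs_lt]; constructor <;> linarith
    · linarith
  have hrpos : 0 < ‖ζ.1‖ * ‖ζ.2.1‖ * ‖ζ.2.2‖ := by
    have : 0 < ‖ζ.1‖ := by linarith
    have : 0 < ‖ζ.2.1‖ := by linarith
    have : 0 < ‖ζ.2.2‖ := by linarith
    positivity
  unfold triWeight RweightAt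
  rw [indicator_of_mem hmem, k0, k1, k2, mul_one, mul_one, mul_one, one_mul, ← ENNReal.ofReal_mul hrpos.le,
    mul_inv_cancel₀ hrpos.ne', ENNReal.ofReal_one]

/-- **The normalised density is the cut-off**: `(C · triWeight(ζ)) · C⁻¹ χ(ζ) = χ(ζ)`. [cite: Tao2016AveragedNS, §3.6 p. 18] -/
theorem density_mul_zCut3At (hξ : IsFrameTriple ξ) (hε : 0 < ε₀) (hε1 : ε₀ ≤ 1 / 10) (ζ : EuclideanSpace ℝ (Fin 3) × EuclideanSpace ℝ (Fin 3) × EuclideanSpace ℝ (Fin 3)) :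
    (rotDensityConstE hε * triWeight (RweightAt ξ hε) ζ).toReal * ((rotDensityConst hε)⁻¹ * zCut3At ξ hε ζ) = zCut3At ξ hε ζ := by
  by_cases hz : zCut3At ξ hε ζ = 0
  · rw [hz, mul_zero, mul_zero]
  · obtain ⟨h0, h1, h2⟩ := near_of_zCut3At_ne_zero hε hz
    rw [triWeight_RweightAt_eq_one hξ hε hε1 h0 h1 h2, mul_one, ← rotDensityConst, ← mul_assoc,
      mul_inv_cancel₀ (rotDensityConst_pos hε).ne', one_mul]

/-- On the support of the cut-offs the pair is good (`ε₀ ≤ 1/100`, (3.24) within `δ > 5500 ε₀³`). [cite: Tao2016AveragedNS, §3.9 (3.24) p. 20] -/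
theorem goodFreq_of_cutoffs_at (hξ : IsFrameTriple ξ) (hε : 0 < ε₀) (hε1 : ε₀ ≤ 1 / 100) (hnd : NondegWithin ξ δ)
    (hδ : 5500 * ε₀ ^ 3 < δ) {p : EuclideanSpace ℝ (Fin 3) × EuclideanSpace ℝ (Fin 3)}
    (hR : pRadAt ξ hε p ≠ 0) (hB : pFrame hε p ≠ 0) : GoodFreq p := by
  have hnear := near_base_of_cutoffs hξ hε hε1 hR hB
  obtain ⟨hne, -, hn1, hn, hlam⟩ := hnd (freq3 p) (fun j => lt_of_le_of_lt (hnear j) hδ) (freq3_sum p)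
  exact ⟨hne, hn1, hn, hlam⟩

variable {p : EuclideanSpace ℝ (Fin 3) × EuclideanSpace ℝ (Fin 3)} {q q' : ℍ × ℍ × ℍ} {θ : Fin 3 → ℝ}

/-- The real cut-off about `ξ` is invariant under the angle actions. [cite: Tao2016AveragedNS, §3.7 (3.19) p. 19] -/
theorem realCutAt_torus (hε : 0 < ε₀) (hp : ∀ j, freq3 p j ≠ 0) (h : IsTorusImage p θ q q') :
    realCutAt ξ hε q' p = realCutAt ξ hε q p := by
  unfold realCutAt zCutAt
  rw [qCut_torus hp h, zetaVec_torus hp h 0, zetaVec_torus hp h 1, zetaVec_torus hp h 2]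

/-- **The integrand along the torus orbit** (all `qⱼ ≠ 0`, `ξ` good):
`F̃'(q') Λ(Y(q')) = realCut(q) Σ_σ [λ_σ⁻¹ ∏ⱼ W^{σⱼ}·cⱼ(q)] e^{-iσ₃θ₃}(e^{-iσ₂θ₂}(e^{-iσ₁θ₁} Λ(R^{θ₁}Y₁, R^{θ₂}Y₂, R^{θ₃}Y₃)))`. [cite: Tao2016AveragedNS, §3.8 p. 19] -/
theorem coreIntegrandAt_torus (hε : 0 < ε₀) (hg : GoodFreq p) (hq : ∀ j, slotQ q j ≠ 0) (θ₁ θ₂ θ₃ : ℝ) :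
    coreIntegrandAt ξ ψ X hε (slotB (norm_quatExp (norm_udir (hg.ne 0)) θ₁)
        (slotC (norm_quatExp (norm_udir (hg.ne 1)) θ₂) (slotA (norm_quatExp (norm_udir (hg.ne 2)) θ₃) q))) p =
      ((realCutAt ξ hε q p : ℝ) : ℂ) *
        ∑ σ : Fin 3 → ℤˣ, ((lamP p σ)⁻¹ * ∏ j, cdot (Wvec p j (σ j)) (cVec ψ q p j)) *
          (Complex.exp (-(Complex.I * ((σ 2 : ℤ) : ℂ) * (θ₃ : ℂ))) *
            (Complex.exp (-(Complex.I * ((σ 1 : ℤ) : ℂ) * (θ₂ : ℂ))) *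
              (Complex.exp (-(Complex.I * ((σ 0 : ℤ) : ℂ) * (θ₁ : ℂ))) *
                Λ (freq3 p 0) (freq3 p 1) (rotMat (rodRotEquiv (hg.ne 0) θ₁) (Yrot X q p 0))
                  (rotMat (rodRotEquiv (hg.ne 1) θ₂) (Yrot X q p 1))
                  (rotMat (rodRotEquiv (hg.ne 2) θ₃) (Yrot X q p 2))))) := by
  have h := isTorusImage_slots hg.ne θ₁ θ₂ θ₃ q
  unfold coreIntegrandAt FflatAt
  rw [realCutAt_torus hε hg.ne h, Ssum_torus hg h hq, Yrot_torus hg.ne h hq 0, Yrot_torus hg.ne h hq 1,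
    Yrot_torus hg.ne h hq 2, mul_assoc, Finset.sum_mul]
  simp only [ang3_zero, ang3_one, ang3_two]
  congr 1
  refine Finset.sum_congr rfl fun σ _ => ?_
  rw [Fin.prod_univ_three, Fin.prod_univ_three]
  simp only [ang3_zero, ang3_one, ang3_two]
  ring

/-- **The fibre identity** (Tao 2016, §3.7–3.9 in quaternion coordinates): for good `ξ` and
every `q`, the torus integral of the joint-weight integrand is
`(2π)³ realCut(q, ξ) ∏ⱼ Xⱼ(ζⱼ) · P_{ζⱼ} \overline{ψ̂ⱼ(ζⱼ)}`. [cite: Tao2016AveragedNS, §3.7–3.9 (3.20)–(3.24) pp. 19–20] -/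
theorem torus_integral_core_at (hε : 0 < ε₀) (hg : GoodFreq p) (q : ℍ × ℍ × ℍ) :
    ∫ θ₃ in (0 : ℝ)..2 * π, ∫ θ₂ in (0 : ℝ)..2 * π, ∫ θ₁ in (0 : ℝ)..2 * π,
      coreIntegrandAt ξ ψ X hε (slotB (norm_quatExp (norm_udir (hg.ne 0)) θ₁)
        (slotC (norm_quatExp (norm_udir (hg.ne 1)) θ₂) (slotA (norm_quatExp (norm_udir (hg.ne 2)) θ₃) q))) p =
      (2 * (π : ℂ)) ^ 3 * (((realCutAt ξ hε q p : ℝ) : ℂ) * hProd ψ X (rotFreq (q, p))) := by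
  by_cases hq : ∀ j, slotQ q j ≠ 0
  · -- the orbit computation
    have hpt : ∀ θ₁ θ₂ θ₃ : ℝ, coreIntegrandAt ξ ψ X hε (slotB (norm_quatExp (norm_udir (hg.ne 0)) θ₁)
        (slotC (norm_quatExp (norm_udir (hg.ne 1)) θ₂) (slotA (norm_quatExp (norm_udir (hg.ne 2)) θ₃) q))) p =
        ((realCutAt ξ hε q p : ℝ) : ℂ) *
          ∑ σ : Fin 3 → ℤˣ, ((lamP p σ)⁻¹ * ∏ j, cdot (Wvec p j (σ j)) (cVec ψ q p j)) *
            (Complex.exp (-(Complex.I * ((σ 2 : ℤ) : ℂ) * (θ₃ : ℂ))) *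
              (Complex.exp (-(Complex.I * ((σ 1 : ℤ) : ℂ) * (θ₂ : ℂ))) *
                (Complex.exp (-(Complex.I * ((σ 0 : ℤ) : ℂ) * (θ₁ : ℂ))) *
                  Λ (freq3 p 0) (freq3 p 1) (rotMat (rodRotEquiv (hg.ne 0) θ₁) (Yrot X q p 0))
                    (rotMat (rodRotEquiv (hg.ne 1) θ₂) (Yrot X q p 1))
                    (rotMat (rodRotEquiv (hg.ne 2) θ₃) (Yrot X q p 2))))) := by
      intro θ₁ θ₂ θ₃
      exact coreIntegrandAt_torus hε hg hq θ₁ θ₂ θ₃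
    have s1 := intervalIntegral.integral_congr (μ := volume) (a := (0 : ℝ)) (b := 2 * π) fun θ₃ _ =>
      intervalIntegral.integral_congr (μ := volume) (a := (0 : ℝ)) (b := 2 * π) fun θ₂ _ =>
        intervalIntegral.integral_congr (μ := volume) (a := (0 : ℝ)) (b := 2 * π) fun θ₁ _ => hpt θ₁ θ₂ θ₃
    rw [s1]
    simp only [intervalIntegral.integral_const_mul]
    have hext := integral_torus_extract_sum (ξ := freq3 p) (n := nVec p) hg.ne hg.norm_n hg.orth
      (fun σ => (lamP p σ)⁻¹ * ∏ j, cdot (Wvec p j (σ j)) (cVec ψ q p j)) (Yrot X q p)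
    rw [hext]
    have hsyn := fibre_synthesis (ξ := freq3 p) (n := nVec p) hg.ne hg.norm_n hg.orth hg.lam (Yrot X q p) (cVec ψ q p)
      (cdot_cVec_axis hg.ne hq)
    have hsyn' : ∑ σ : Fin 3 → ℤˣ, (lamP p σ)⁻¹ * (∏ j, cdot (Wvec p j (σ j)) (cVec ψ q p j)) *
        Λ (freq3 p 0) (freq3 p 1) (specProj (freq3 p 0) (nVec p) (σ 0) (Yrot X q p 0))
          (specProj (freq3 p 1) (nVec p) (σ 1) (Yrot X q p 1))
          (specProj (freq3 p 2) (nVec p) (σ 2) (Yrot X q p 2)) = ∏ j, cdot (Yrot X q p j) (cVec ψ q p j) := hsyn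
    rw [hsyn', Fin.prod_univ_three, cdot_Yrot_cVec hq, cdot_Yrot_cVec hq, cdot_Yrot_cVec hq]
    unfold hProd
    rw [rotFreq_eq]
    ring
  · -- some `qⱼ = 0`: both sides vanish
    simp only [not_forall, not_not] at hq
    obtain ⟨j, hj⟩ := hq
    have hzero : ∀ θ₁ θ₂ θ₃ : ℝ, coreIntegrandAt ξ ψ X hε (slotB (norm_quatExp (norm_udir (hg.ne 0)) θ₁)
        (slotC (norm_quatExp (norm_udir (hg.ne 1)) θ₂) (slotA (norm_quatExp (norm_udir (hg.ne 2)) θ₃) q))) p = 0 := by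
      intro θ₁ θ₂ θ₃
      unfold coreIntegrandAt FflatAt
      rw [realCutAt_torus hε hg.ne (isTorusImage_slots hg.ne θ₁ θ₂ θ₃ q), realCutAt,
        qCut_eq_zero_of_norm_lt (j := j) (by rw [hj, norm_zero]; norm_num)]
      simp only [zero_mul, Complex.ofReal_zero]
    have s1 := intervalIntegral.integral_congr (μ := volume) (a := (0 : ℝ)) (b := 2 * π) fun θ₃ _ =>
      intervalIntegral.integral_congr (μ := volume) (a := (0 : ℝ)) (b := 2 * π) fun θ₂ _ =>
        intervalIntegral.integral_congr (μ := volume) (a := (0 : ℝ)) (b := 2 * π) fun θ₁ _ => hzero θ₁ θ₂ θ₃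
    rw [s1]
    rw [realCutAt, qCut_eq_zero_of_norm_lt (j := j) (by rw [hj, norm_zero]; norm_num)]
    simp

/-- **The disintegration weight in real terms**: `(rotWeight x).toReal = qDensity · qCut · pRadAt · pFrame`. [cite: Tao2016AveragedNS, §3.6 p. 18] -/
theorem rotWeight_toReal_at (hε : 0 < ε₀) (x : (ℍ × ℍ × ℍ) × (EuclideanSpace ℝ (Fin 3) × EuclideanSpace ℝ (Fin 3))) :
    (rotWeight gTotal (RweightAt ξ hε) (Bweight hε) x).toReal = qDensity x.1 * qCut x.1 * pRadAt ξ hε x.2 * pFrame hε x.2 := by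
  have hg : ∀ t : ℝ, 0 ≤ gBump t * gBump2 (t ^ 2) := fun t => mul_nonneg gBump.nonneg gBump2.nonneg
  have hR : 0 ≤ pRadAt ξ hε x.2 := by
    unfold pRadAt
    exact mul_nonneg (by positivity) (mul_nonneg (mul_nonneg (kappaBumpAt ξ hε 0).nonneg (kappaBumpAt ξ hε 1).nonneg)
      (kappaBumpAt ξ hε 2).nonneg)
  have hB : 0 ≤ pFrame hε x.2 := mul_nonneg (dirBump hε).nonneg (normalBump hε).nonneg
  unfold rotWeight frameWeight gTotal
  have eR : RweightAt ξ hε ‖x.2.1‖ ‖x.2.2‖ ‖-x.2.1 - x.2.2‖ = ENNReal.ofReal (pRadAt ξ hε x.2) := rfl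
  have eB : Bweight hε (udir (-x.2.1 - x.2.2)) (udir (cross x.2.1 x.2.2)) = ENNReal.ofReal (pFrame hε x.2) := rfl
  rw [eR, eB]
  simp only [ENNReal.toReal_mul, ENNReal.toReal_ofReal (hg _), ENNReal.toReal_ofReal hR, ENNReal.toReal_ofReal hB]
  unfold qDensity qCut
  ring

/-- The disintegration weight is finite. [cite: Tao2016AveragedNS, §3.6 p. 18] -/
theorem rotWeight_lt_top_at (hε : 0 < ε₀) (x : (ℍ × ℍ × ℍ) × (EuclideanSpace ℝ (Fin 3) × EuclideanSpace ℝ (Fin 3))) :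
    rotWeight gTotal (RweightAt ξ hε) (Bweight hε) x < ⊤ := by
  unfold rotWeight frameWeight gTotal RweightAt Bweight
  exact ENNReal.mul_lt_top (ENNReal.mul_lt_top (ENNReal.mul_lt_top ENNReal.ofReal_lt_top ENNReal.ofReal_lt_top)
    ENNReal.ofReal_lt_top) (ENNReal.mul_lt_top ENNReal.ofReal_lt_top ENNReal.ofReal_lt_top)

/-- Measurability of the magnitude weight. [cite: Tao2016AveragedNS, §3.6 p. 18] -/
theorem measurable_RweightAt (hε : 0 < ε₀) : Measurable fun r : ℝ × ℝ × ℝ => RweightAt ξ hε r.1 r.2.1 r.2.2 := by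
  unfold RweightAt
  refine ENNReal.measurable_ofReal.comp ?_
  have h1 : Measurable fun r : ℝ × ℝ × ℝ => r.1 := measurable_fst
  have h2 : Measurable fun r : ℝ × ℝ × ℝ => r.2.1 := measurable_fst.comp measurable_snd
  have h3 : Measurable fun r : ℝ × ℝ × ℝ => r.2.2 := measurable_snd.comp measurable_snd
  exact ((h1.mul h2).mul h3).mul ((((kappaBumpAt ξ hε 0).continuous.measurable.comp h1).mul
    ((kappaBumpAt ξ hε 1).continuous.measurable.comp h2)).mul ((kappaBumpAt ξ hε 2).continuous.measurable.comp h3))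

/-- The disintegration weight is measurable. [cite: Tao2016AveragedNS, §3.6 p. 18] -/
theorem measurable_rotWeightAt (hε : 0 < ε₀) : Measurable (rotWeight gTotal (RweightAt ξ hε) (Bweight hε)) :=
  measurable_rotWeight measurable_gTotal (measurable_RweightAt (ξ := ξ) hε) (measurable_Bweight hε)

/-- **The disintegration applied to a separated product**: for measurable `hⱼ ≥ 0`,
`∫ rotWeight(x) ∏ⱼ hⱼ(ζⱼ(x)) dx ≤ C ∏ⱼ ∫ hⱼ`. [cite: Tao2016AveragedNS, §3.6 p. 18] -/
theorem lintegral_rotWeightAt_prod_le (hε : 0 < ε₀) {h : Fin 3 → EuclideanSpace ℝ (Fin 3) → ℝ≥0∞} (hh : ∀ j, Measurable (h j)) :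
    ∫⁻ x : (ℍ × ℍ × ℍ) × (EuclideanSpace ℝ (Fin 3) × EuclideanSpace ℝ (Fin 3)), rotWeight gTotal (RweightAt ξ hε) (Bweight hε) x *
        (h 0 (zetaVec x.1 x.2 0) * h 1 (zetaVec x.1 x.2 1) * h 2 (zetaVec x.1 x.2 2)) ≤
      rotDensityConstE hε * ((∫⁻ v, h 0 v) * ((∫⁻ v, h 1 v) * ∫⁻ v, h 2 v)) := by
  have hH : Measurable fun ζ : EuclideanSpace ℝ (Fin 3) × EuclideanSpace ℝ (Fin 3) × EuclideanSpace ℝ (Fin 3) => h 0 ζ.1 * h 1 ζ.2.1 * h 2 ζ.2.2 :=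
    (((hh 0).comp measurable_fst).mul ((hh 1).comp (measurable_fst.comp measurable_snd))).mul
      ((hh 2).comp (measurable_snd.comp measurable_snd))
  have hD := lintegral_rotation_disintegration gTotal measurable_gTotal (RweightAt ξ hε) (measurable_RweightAt (ξ := ξ) hε)
    (Bweight hε) (measurable_Bweight hε) _ hH
  have hlhs : ∫⁻ x : (ℍ × ℍ × ℍ) × (EuclideanSpace ℝ (Fin 3) × EuclideanSpace ℝ (Fin 3)), rotWeight gTotal (RweightAt ξ hε) (Bweight hε) x *
      (h 0 (zetaVec x.1 x.2 0) * h 1 (zetaVec x.1 x.2 1) * h 2 (zetaVec x.1 x.2 2)) =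
      ∫⁻ x : (ℍ × ℍ × ℍ) × (EuclideanSpace ℝ (Fin 3) × EuclideanSpace ℝ (Fin 3)), gTotal ‖x.1.1‖ * gTotal ‖x.1.2.1‖ * gTotal ‖x.1.2.2‖ *
        frameWeight (RweightAt ξ hε) (Bweight hε) x.2 *
          (h 0 (qrotFun (star x.1.2.1) x.2.1) * h 1 (qrotFun (star x.1.2.2) x.2.2) *
            h 2 (qrotFun (star x.1.1) (-x.2.1 - x.2.2))) := rfl
  rw [hlhs, hD, rotDensityConstE]
  gcongr
  calc ∫⁻ ζ : EuclideanSpace ℝ (Fin 3) × EuclideanSpace ℝ (Fin 3) × EuclideanSpace ℝ (Fin 3), triWeight (RweightAt ξ hε) ζ * (h 0 ζ.1 * h 1 ζ.2.1 * h 2 ζ.2.2)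
      ≤ ∫⁻ ζ : EuclideanSpace ℝ (Fin 3) × EuclideanSpace ℝ (Fin 3) × EuclideanSpace ℝ (Fin 3), h 0 ζ.1 * (h 1 ζ.2.1 * h 2 ζ.2.2) := by
        refine lintegral_mono fun ζ => ?_
        calc _ ≤ 1 * (h 0 ζ.1 * h 1 ζ.2.1 * h 2 ζ.2.2) := by gcongr; exact triWeight_RweightAt_le_one (ξ := ξ) hε ζ
          _ = _ := by ring
    _ = ∫⁻ ζ : EuclideanSpace ℝ (Fin 3) × EuclideanSpace ℝ (Fin 3) × EuclideanSpace ℝ (Fin 3), h 0 ζ.1 * (h 1 ζ.2.1 * h 2 ζ.2.2) ∂((volume : Measure (EuclideanSpace ℝ (Fin 3))).prod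
          (volume : Measure (EuclideanSpace ℝ (Fin 3) × EuclideanSpace ℝ (Fin 3)))) := by rw [← Measure.volume_eq_prod]
    _ = (∫⁻ v, h 0 v) * ∫⁻ w : EuclideanSpace ℝ (Fin 3) × EuclideanSpace ℝ (Fin 3), h 1 w.1 * h 2 w.2 :=
        lintegral_prod_mul (hh 0).aemeasurable (((hh 1).comp measurable_fst).mul ((hh 2).comp measurable_snd)).aemeasurable
    _ = (∫⁻ v, h 0 v) * ∫⁻ w : EuclideanSpace ℝ (Fin 3) × EuclideanSpace ℝ (Fin 3), h 1 w.1 * h 2 w.2 ∂((volume : Measure (EuclideanSpace ℝ (Fin 3))).prod (volume : Measure (EuclideanSpace ℝ (Fin 3)))) := by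
        rw [← Measure.volume_eq_prod]
    _ = (∫⁻ v, h 0 v) * ((∫⁻ v, h 1 v) * ∫⁻ v, h 2 v) := by
        rw [lintegral_prod_mul (hh 1).aemeasurable (hh 2).aemeasurable]

/-- `cutSupportAt` is compact. [cite: Tao2016AveragedNS, §3.6 p. 18] -/
theorem isCompact_cutSupportAt (ξ : Fin 3 → EuclideanSpace ℝ (Fin 3)) (ε₀ : ℝ) : IsCompact (cutSupportAt ξ ε₀) := by
  have hclosed : IsClosed (cutSupportAt ξ ε₀) := by
    have h1 : ∀ j, IsClosed {x : (ℍ × ℍ × ℍ) × (EuclideanSpace ℝ (Fin 3) × EuclideanSpace ℝ (Fin 3)) | 1 / 2 ≤ ‖slotQ x.1 j‖ ∧ ‖slotQ x.1 j‖ ≤ 2} := by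
      intro j
      have hc : Continuous fun x : (ℍ × ℍ × ℍ) × (EuclideanSpace ℝ (Fin 3) × EuclideanSpace ℝ (Fin 3)) => ‖slotQ x.1 j‖ :=
        ((contDiff_slotQ j).continuous.comp continuous_fst).norm
      exact (isClosed_le continuous_const hc).inter (isClosed_le hc continuous_const)
    have h2 : ∀ j, IsClosed {x : (ℍ × ℍ × ℍ) × (EuclideanSpace ℝ (Fin 3) × EuclideanSpace ℝ (Fin 3)) | ‖freq3 x.2 j - ξ j‖ ≤ 5500 * ε₀ ^ 3} := fun j =>
      isClosed_le ((((contDiff_freq3_apply j).continuous.comp continuous_snd).sub continuous_const).norm)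
        continuous_const
    have : cutSupportAt ξ ε₀ = (⋂ j, {x | 1 / 2 ≤ ‖slotQ x.1 j‖ ∧ ‖slotQ x.1 j‖ ≤ 2}) ∩
        ⋂ j, {x | ‖freq3 x.2 j - ξ j‖ ≤ 5500 * ε₀ ^ 3} := by
      ext x; simp [cutSupportAt]
    rw [this]
    exact (isClosed_iInter h1).inter (isClosed_iInter h2)
  refine Metric.isCompact_of_isClosed_isBounded hclosed ?_
  refine (Metric.isBounded_closedBall (x := (0 : (ℍ × ℍ × ℍ) × (EuclideanSpace ℝ (Fin 3) × EuclideanSpace ℝ (Fin 3))))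
    (r := 2 + (‖ξ 0‖ + ‖ξ 1‖) + 5500 * |ε₀| ^ 3)).subset ?_
  intro x hx
  obtain ⟨hq, hp⟩ := hx
  rw [Metric.mem_closedBall, dist_zero_right]
  have hε3 : 5500 * ε₀ ^ 3 ≤ 5500 * |ε₀| ^ 3 := by
    have : ε₀ ^ 3 ≤ |ε₀| ^ 3 := (le_abs_self _).trans_eq (abs_pow ε₀ 3)
    linarith
  have hp' : ∀ j, ‖freq3 x.2 j‖ ≤ ‖ξ j‖ + 5500 * |ε₀| ^ 3 := by
    intro j
    calc ‖freq3 x.2 j‖ ≤ ‖freq3 x.2 j - ξ j‖ + ‖ξ j‖ := norm_le_norm_sub_add _ _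
      _ ≤ 5500 * ε₀ ^ 3 + ‖ξ j‖ := add_le_add (hp j) le_rfl
      _ ≤ ‖ξ j‖ + 5500 * |ε₀| ^ 3 := by linarith
  have h0 : (0 : ℝ) ≤ 5500 * |ε₀| ^ 3 := by positivity
  have hn0 := norm_nonneg (ξ 0)
  have hn1 := norm_nonneg (ξ 1)
  simp only [Prod.norm_def, max_le_iff]
  refine ⟨⟨?_, ?_, ?_⟩, ?_, ?_⟩
  · linarith [(hq 2).2, show ‖x.1.1‖ = ‖slotQ x.1 2‖ from rfl]
  · linarith [(hq 0).2, show ‖x.1.2.1‖ = ‖slotQ x.1 0‖ from rfl]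
  · linarith [(hq 1).2, show ‖x.1.2.2‖ = ‖slotQ x.1 1‖ from rfl]
  · linarith [hp' 0, show ‖x.2.1‖ = ‖freq3 x.2 0‖ from rfl]
  · linarith [hp' 1, show ‖x.2.2‖ = ‖freq3 x.2 1‖ from rfl]

/-- `cutSupportAt ⊆ GoodSetAt ξ δ` when `5500 ε₀³ < δ`. [cite: Tao2016AveragedNS, §3.7 (3.18) p. 19] -/
theorem cutSupportAt_subset_goodSetAt (hδ : 5500 * ε₀ ^ 3 < δ) : cutSupportAt ξ ε₀ ⊆ GoodSetAt ξ δ := by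
  intro x hx
  obtain ⟨hq, hp⟩ := hx
  refine ⟨fun j h0 => ?_, fun j => lt_of_le_of_lt (hp j) hδ⟩
  have := (hq j).1
  rw [h0, norm_zero] at this
  linarith

/-- Where the real cut-off is non-zero we are in `cutSupportAt` (`ε₀ ≤ 1/100`). [cite: Tao2016AveragedNS, §3.6 p. 18] -/
theorem mem_cutSupportAt_of_realCutAt_ne_zero (hξ : IsFrameTriple ξ) (hε : 0 < ε₀) (hε1 : ε₀ ≤ 1 / 100) {q : ℍ × ℍ × ℍ}
    {p : EuclideanSpace ℝ (Fin 3) × EuclideanSpace ℝ (Fin 3)}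
    (h : realCutAt ξ hε q p ≠ 0) : (q, p) ∈ cutSupportAt ξ ε₀ := by
  unfold realCutAt at h
  simp only [mul_ne_zero_iff] at h
  obtain ⟨⟨⟨⟨hq, hR⟩, hB⟩, -⟩, -⟩ := h
  refine ⟨fun j => ⟨?_, ?_⟩, near_base_of_cutoffs hξ hε hε1 hR hB⟩
  · by_contra hlt
    exact hq (qCut_eq_zero_of_norm_lt (j := j) (not_le.mp hlt))
  · by_contra hlt
    have key : ∀ t : ℝ, 2 < t → (gBump2 : ℝ → ℝ) (t ^ 2) = 0 := by
      intro t ht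
      apply gBump2.zero_of_le_dist
      rw [Real.dist_eq, show gBump2.rOut = 3 / 4 from rfl, abs_of_pos (by nlinarith)]
      nlinarith
    apply hq
    unfold qCut
    fin_cases j
    · change ¬‖q.2.1‖ ≤ 2 at hlt; rw [key _ (not_le.mp hlt)]; ring
    · change ¬‖q.2.2‖ ≤ 2 at hlt; rw [key _ (not_le.mp hlt)]; ring
    · change ¬‖q.1‖ ≤ 2 at hlt; rw [key _ (not_le.mp hlt)]; ring

/-- **The synthesis sum is bounded on the support of the cut-off.** [cite: Tao2016AveragedNS, §3.8 p. 19] -/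
theorem exists_bound_Ssum_at (hnd : NondegWithin ξ δ) (hδ : 5500 * ε₀ ^ 3 < δ) :
    ∃ S : ℝ, 0 ≤ S ∧ ∀ x ∈ cutSupportAt ξ ε₀, ‖Ssum ψ x.1 x.2‖ ≤ S := by
  have hcont : ContinuousOn (fun x : (ℍ × ℍ × ℍ) × (EuclideanSpace ℝ (Fin 3) × EuclideanSpace ℝ (Fin 3)) => Ssum ψ x.1 x.2) (cutSupportAt ξ ε₀) := fun x hx =>
    (contDiffAt_Ssum_at (ψ := ψ) hnd (cutSupportAt_subset_goodSetAt hδ hx)).continuousAt.continuousWithinAt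
  obtain ⟨S, hS⟩ := (isCompact_cutSupportAt ξ ε₀).exists_bound_of_continuousOn hcont
  exact ⟨max S 0, le_max_right _ _, fun x hx => (hS x hx).trans (le_max_left _ _)⟩

/-- `G` is measurable (for measurable `Xⱼ`). [cite: Tao2016AveragedNS, §3.6 (3.16) p. 18] -/
theorem measurable_GfunAt (hξ : IsFrameTriple ξ) (hε : 0 < ε₀) (hε1 : ε₀ ≤ 1 / 100) (hnd : NondegWithin ξ δ)
    (hδ : 5500 * ε₀ ^ 3 < δ) (hX : ∀ j, Measurable (X j)) :
    Measurable (GfunAt ξ ψ X hε) := by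
  unfold GfunAt coreIntegrandAt
  have hq : Measurable fun x : (ℍ × ℍ × ℍ) × (EuclideanSpace ℝ (Fin 3) × EuclideanSpace ℝ (Fin 3)) => ((qDensity x.1 : ℝ) : ℂ) :=
    Complex.measurable_ofReal.comp (continuous_qDensity.measurable.comp measurable_fst)
  have hw : Measurable fun x : (ℍ × ℍ × ℍ) × (EuclideanSpace ℝ (Fin 3) × EuclideanSpace ℝ (Fin 3)) => singleScaleWeightAtC ξ ε₀ x.2 :=
    (measurable_singleScaleWeightAtC ξ ε₀).comp measurable_snd
  have hF : Measurable fun x : (ℍ × ℍ × ℍ) × (EuclideanSpace ℝ (Fin 3) × EuclideanSpace ℝ (Fin 3)) => FflatAt ξ ψ hε x.1 x.2 :=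
    (contDiff_FflatAt (ψ := ψ) hξ hε hε1 hnd hδ).continuous.measurable
  have hΛ : Measurable fun x : (ℍ × ℍ × ℍ) × (EuclideanSpace ℝ (Fin 3) × EuclideanSpace ℝ (Fin 3)) =>
      Λ (freq3 x.2 0) (freq3 x.2 1) (Yrot X x.1 x.2 0) (Yrot X x.1 x.2 1) (Yrot X x.1 x.2 2) := by
    have h := continuous_Λ_all.measurable.comp
      ((((contDiff_freq3_apply 0).continuous.measurable.comp measurable_snd).prodMk
        ((contDiff_freq3_apply 1).continuous.measurable.comp measurable_snd)).prodMk
        ((measurable_Yrot hX 0).prodMk ((measurable_Yrot hX 1).prodMk (measurable_Yrot hX 2))))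
    exact h
  exact hq.mul (hw.mul (hF.mul hΛ))

/-- The real cut-off is measurable. [cite: Tao2016AveragedNS, §3.6 p. 18] -/
theorem measurable_realCutAt (hε : 0 < ε₀) : Measurable fun x : (ℍ × ℍ × ℍ) × (EuclideanSpace ℝ (Fin 3) × EuclideanSpace ℝ (Fin 3)) => realCutAt ξ hε x.1 x.2 := by
  unfold realCutAt
  have hqCut : Measurable fun x : (ℍ × ℍ × ℍ) × (EuclideanSpace ℝ (Fin 3) × EuclideanSpace ℝ (Fin 3)) => qCut x.1 := by
    unfold qCut
    have hn : ∀ {f : (ℍ × ℍ × ℍ) × (EuclideanSpace ℝ (Fin 3) × EuclideanSpace ℝ (Fin 3)) → ℍ}, Measurable f →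
        Measurable fun x => (gBump2 : ℝ → ℝ) (‖f x‖ ^ 2) := fun hf =>
      gBump2.continuous.measurable.comp (hf.norm.pow_const 2)
    exact ((hn (measurable_fst.comp measurable_fst)).mul (hn ((measurable_fst.comp measurable_snd).comp measurable_fst))).mul
      (hn ((measurable_snd.comp measurable_snd).comp measurable_fst))
  have hf : ∀ j, Measurable fun x : (ℍ × ℍ × ℍ) × (EuclideanSpace ℝ (Fin 3) × EuclideanSpace ℝ (Fin 3)) => freq3 x.2 j := fun j =>
    (contDiff_freq3_apply j).continuous.measurable.comp measurable_snd
  have hpRad : Measurable fun x : (ℍ × ℍ × ℍ) × (EuclideanSpace ℝ (Fin 3) × EuclideanSpace ℝ (Fin 3)) => pRadAt ξ hε x.2 := by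
    unfold pRadAt
    exact (((hf 0).norm.mul (hf 1).norm).mul (hf 2).norm).mul
      ((((kappaBumpAt ξ hε 0).continuous.measurable.comp (hf 0).norm).mul
        ((kappaBumpAt ξ hε 1).continuous.measurable.comp (hf 1).norm)).mul
        ((kappaBumpAt ξ hε 2).continuous.measurable.comp (hf 2).norm))
  have hpFrame : Measurable fun x : (ℍ × ℍ × ℍ) × (EuclideanSpace ℝ (Fin 3) × EuclideanSpace ℝ (Fin 3)) => pFrame hε x.2 := by
    unfold pFrame nVec gammaNormal
    exact ((dirBump hε).continuous.measurable.comp (measurable_udir.comp (hf 2))).mul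
      ((normalBump hε).continuous.measurable.comp (measurable_udir.comp
        ((contDiff_cross (n := 0)).continuous.measurable.comp ((hf 0).prodMk (hf 1)))))
  have hzCut : Measurable fun x : (ℍ × ℍ × ℍ) × (EuclideanSpace ℝ (Fin 3) × EuclideanSpace ℝ (Fin 3)) => zCutAt ξ hε x.1 x.2 := by
    unfold zCutAt
    exact (((zetaBumpAt ξ hε 0).continuous.measurable.comp (measurable_zetaVec 0)).mul
      ((zetaBumpAt ξ hε 1).continuous.measurable.comp (measurable_zetaVec 1))).mul
      ((zetaBumpAt ξ hε 2).continuous.measurable.comp (measurable_zetaVec 2))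
  exact (((hqCut.mul hpRad).mul hpFrame).mul hzCut).mul measurable_const

/-- `N` is measurable. [cite: Tao2016AveragedNS, §3.6 (3.15) p. 18] -/
theorem measurable_NfunAt (hε : 0 < ε₀) (hX : ∀ j, Measurable (X j)) : Measurable (NfunAt ξ ψ X hε) := by
  unfold NfunAt
  exact (Complex.measurable_ofReal.comp ((continuous_qDensity.measurable.comp measurable_fst).mul
    (measurable_realCutAt (ξ := ξ) hε))).mul ((measurable_hProd hX).comp measurable_rotFreq)

/-- `realCutAt ≥ 0`. [cite: Tao2016AveragedNS, §3.6 p. 18] -/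
theorem realCutAt_nonneg (hε : 0 < ε₀) (q : ℍ × ℍ × ℍ) (p : EuclideanSpace ℝ (Fin 3) × EuclideanSpace ℝ (Fin 3)) : 0 ≤ realCutAt ξ hε q p := by
  unfold realCutAt qCut pRadAt pFrame zCutAt
  have := (rotDensityConst_pos hε).le
  exact mul_nonneg (mul_nonneg (mul_nonneg (mul_nonneg
    (mul_nonneg (mul_nonneg gBump2.nonneg gBump2.nonneg) gBump2.nonneg)
    (mul_nonneg (by positivity) (mul_nonneg (mul_nonneg (kappaBumpAt ξ hε 0).nonneg (kappaBumpAt ξ hε 1).nonneg)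
      (kappaBumpAt ξ hε 2).nonneg)))
    (mul_nonneg (dirBump hε).nonneg (normalBump hε).nonneg))
    (mul_nonneg (mul_nonneg (zetaBumpAt ξ hε 0).nonneg (zetaBumpAt ξ hε 1).nonneg) (zetaBumpAt ξ hε 2).nonneg))
    (inv_nonneg.mpr this)

/-- `realCutAt ≤ qCut · pRadAt · pFrame / C` (as `zCutAt ≤ 1`). [cite: Tao2016AveragedNS, §3.6 p. 18] -/
theorem realCutAt_le (hε : 0 < ε₀) (q : ℍ × ℍ × ℍ) (p : EuclideanSpace ℝ (Fin 3) × EuclideanSpace ℝ (Fin 3)) :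
    realCutAt ξ hε q p ≤ qCut q * pRadAt ξ hε p * pFrame hε p * (rotDensityConst hε)⁻¹ := by
  unfold realCutAt
  have hC := (rotDensityConst_pos hε).le
  have hz1 : zCutAt ξ hε q p ≤ 1 := by rw [zCutAt_eq_zCut3At ξ]; exact (zCut3At_nonneg_le_one (ξ := ξ) hε _).2
  have hz0 : 0 ≤ zCutAt ξ hε q p := by rw [zCutAt_eq_zCut3At ξ]; exact (zCut3At_nonneg_le_one (ξ := ξ) hε _).1
  have hA : 0 ≤ qCut q * pRadAt ξ hε p * pFrame hε p := by
    unfold qCut pRadAt pFrame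
    exact mul_nonneg (mul_nonneg (mul_nonneg (mul_nonneg gBump2.nonneg gBump2.nonneg) gBump2.nonneg)
      (mul_nonneg (by positivity) (mul_nonneg (mul_nonneg (kappaBumpAt ξ hε 0).nonneg (kappaBumpAt ξ hε 1).nonneg)
        (kappaBumpAt ξ hε 2).nonneg))) (mul_nonneg (dirBump hε).nonneg (normalBump hε).nonneg)
  calc _ ≤ qCut q * pRadAt ξ hε p * pFrame hε p * 1 * (rotDensityConst hε)⁻¹ := by gcongr
    _ = _ := by rw [mul_one]

/-- On `cutSupportAt`, `|ζ₂| + |ζ₁| ≤ 5` (`ε₀ ≤ 1/100`, window sides `≤ 3/2`). [cite: Tao2016AveragedNS, §3.6 p. 18] -/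
theorem norm_freq_sum_le_at (hξ : IsFrameTriple ξ) {x : (ℍ × ℍ × ℍ) × (EuclideanSpace ℝ (Fin 3) × EuclideanSpace ℝ (Fin 3))}
    (hε : 0 < ε₀) (hε1 : ε₀ ≤ 1 / 100) (hx : x ∈ cutSupportAt ξ ε₀) :
    ‖freq3 x.2 1‖ + ‖freq3 x.2 0‖ ≤ 5 := by
  obtain ⟨-, hp⟩ := hx
  have ht : ε₀ ^ 3 ≤ 1 / 1000000 := by
    calc ε₀ ^ 3 ≤ (1 / 100) ^ 3 := by gcongr
      _ = 1 / 1000000 := by norm_num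
  have h0 : ‖freq3 x.2 0‖ ≤ 5500 * ε₀ ^ 3 + 3 / 2 := by
    calc ‖freq3 x.2 0‖ ≤ ‖freq3 x.2 0 - ξ 0‖ + ‖ξ 0‖ := norm_le_norm_sub_add _ _
      _ ≤ 5500 * ε₀ ^ 3 + 3 / 2 := add_le_add (hp 0) (hξ.window 0).2
  have h1 : ‖freq3 x.2 1‖ ≤ 5500 * ε₀ ^ 3 + 3 / 2 := by
    calc ‖freq3 x.2 1‖ ≤ ‖freq3 x.2 1 - ξ 1‖ + ‖ξ 1‖ := norm_le_norm_sub_add _ _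
      _ ≤ 5500 * ε₀ ^ 3 + 3 / 2 := add_le_add (hp 1) (hξ.window 1).2
  linarith

/-- **Pointwise bound for `G`**: `|G| ≤ 5 S C⁻¹ · rotWeight · ∏ⱼ |Xⱼ(ζⱼ)|`. [cite: Tao2016AveragedNS, §3.6 p. 18] -/
theorem norm_GfunAt_le (hξ : IsFrameTriple ξ) (hε : 0 < ε₀) (hε1 : ε₀ ≤ 1 / 100) {S : ℝ} (hS0 : 0 ≤ S)
    (hS : ∀ x ∈ cutSupportAt ξ ε₀, ‖Ssum ψ x.1 x.2‖ ≤ S) (x : (ℍ × ℍ × ℍ) × (EuclideanSpace ℝ (Fin 3) × EuclideanSpace ℝ (Fin 3))) :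
    ‖GfunAt ξ ψ X hε x‖ ≤ (5 * S * (rotDensityConst hε)⁻¹) *
      ((rotWeight gTotal (RweightAt ξ hε) (Bweight hε) x).toReal *
        (‖X 0 (zetaVec x.1 x.2 0)‖ * ‖X 1 (zetaVec x.1 x.2 1)‖ * ‖X 2 (zetaVec x.1 x.2 2)‖)) := by
  have hC := (rotDensityConst_pos hε).le
  by_cases hrc : realCutAt ξ hε x.1 x.2 = 0
  · have : GfunAt ξ ψ X hε x = 0 := by
      unfold GfunAt coreIntegrandAt FflatAt; rw [hrc]; simp only [Complex.ofReal_zero, zero_mul, mul_zero]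
    rw [this, norm_zero]
    exact mul_nonneg (mul_nonneg (by linarith) (inv_nonneg.mpr hC)) (mul_nonneg ENNReal.toReal_nonneg (by positivity))
  · have hmem := mem_cutSupportAt_of_realCutAt_ne_zero hξ hε hε1 hrc
    have hq : ∀ j, slotQ x.1 j ≠ 0 := fun j h0 => by
      have := (hmem.1 j).1; rw [h0, norm_zero] at this; linarith
    have h5 := norm_freq_sum_le_at hξ hε hε1 hmem
    have hrc0 := realCutAt_nonneg (ξ := ξ) hε x.1 x.2
    have hqd := qDensity_nonneg x.1
    -- the norm of the integrand
    have e : ‖GfunAt ξ ψ X hε x‖ = qDensity x.1 * (‖singleScaleWeightAtC ξ ε₀ x.2‖ * (realCutAt ξ hε x.1 x.2 * ‖Ssum ψ x.1 x.2‖ *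
        ‖Λ (freq3 x.2 0) (freq3 x.2 1) (Yrot X x.1 x.2 0) (Yrot X x.1 x.2 1) (Yrot X x.1 x.2 2)‖)) := by
      unfold GfunAt coreIntegrandAt FflatAt
      rw [norm_mul, norm_mul, norm_mul, norm_mul, Complex.norm_real, Complex.norm_real,
        Real.norm_eq_abs, Real.norm_eq_abs, abs_of_nonneg hqd, abs_of_nonneg hrc0]
    rw [e]
    have hΛ := norm_Λ_le' (freq3 x.2 0) (freq3 x.2 1) (Yrot X x.1 x.2 0) (Yrot X x.1 x.2 1) (Yrot X x.1 x.2 2)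
    rw [norm_Yrot hq, norm_Yrot hq, norm_Yrot hq] at hΛ
    set P := ‖X 0 (zetaVec x.1 x.2 0)‖ * ‖X 1 (zetaVec x.1 x.2 1)‖ * ‖X 2 (zetaVec x.1 x.2 2)‖ with hP
    have hP0 : 0 ≤ P := by positivity
    have hw := norm_singleScaleWeightAtC_le_one ξ ε₀ x.2
    have hrl := realCutAt_le (ξ := ξ) hε x.1 x.2
    have hSS : ‖Ssum ψ x.1 x.2‖ ≤ S := hS x hmem
    have hΛ5 : ‖Λ (freq3 x.2 0) (freq3 x.2 1) (Yrot X x.1 x.2 0) (Yrot X x.1 x.2 1) (Yrot X x.1 x.2 2)‖ ≤ 5 * P :=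
      hΛ.trans (mul_le_mul_of_nonneg_right h5 hP0)
    have hB0 : 0 ≤ qCut x.1 * pRadAt ξ hε x.2 * pFrame hε x.2 * (rotDensityConst hε)⁻¹ := hrc0.trans hrl
    have h1 : realCutAt ξ hε x.1 x.2 * ‖Ssum ψ x.1 x.2‖ ≤ qCut x.1 * pRadAt ξ hε x.2 * pFrame hε x.2 * (rotDensityConst hε)⁻¹ * S :=
      mul_le_mul hrl hSS (norm_nonneg _) hB0
    have h2 : realCutAt ξ hε x.1 x.2 * ‖Ssum ψ x.1 x.2‖ *
        ‖Λ (freq3 x.2 0) (freq3 x.2 1) (Yrot X x.1 x.2 0) (Yrot X x.1 x.2 1) (Yrot X x.1 x.2 2)‖ ≤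
        qCut x.1 * pRadAt ξ hε x.2 * pFrame hε x.2 * (rotDensityConst hε)⁻¹ * S * (5 * P) :=
      mul_le_mul h1 hΛ5 (norm_nonneg _) (mul_nonneg hB0 hS0)
    have h3 : ‖singleScaleWeightAtC ξ ε₀ x.2‖ * (realCutAt ξ hε x.1 x.2 * ‖Ssum ψ x.1 x.2‖ *
        ‖Λ (freq3 x.2 0) (freq3 x.2 1) (Yrot X x.1 x.2 0) (Yrot X x.1 x.2 1) (Yrot X x.1 x.2 2)‖) ≤
        1 * (qCut x.1 * pRadAt ξ hε x.2 * pFrame hε x.2 * (rotDensityConst hε)⁻¹ * S * (5 * P)) :=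
      mul_le_mul hw h2 (mul_nonneg (mul_nonneg hrc0 (norm_nonneg _)) (norm_nonneg _)) zero_le_one
    calc _ ≤ qDensity x.1 * (1 * (qCut x.1 * pRadAt ξ hε x.2 * pFrame hε x.2 * (rotDensityConst hε)⁻¹ * S * (5 * P))) :=
          mul_le_mul_of_nonneg_left h3 hqd
      _ = (5 * S * (rotDensityConst hε)⁻¹) * ((qDensity x.1 * qCut x.1 * pRadAt ξ hε x.2 * pFrame hε x.2) * P) := by ring
      _ = _ := by rw [rotWeight_toReal_at (ξ := ξ) hε x]

/-- **Pointwise bound for `N`**: `|N| ≤ 8A³ C⁻¹ · rotWeight · ∏ⱼ |Xⱼ(ζⱼ)|`. [cite: Tao2016AveragedNS, §3.6 p. 18] -/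
theorem norm_NfunAt_le (hε : 0 < ε₀) {A : ℝ} (hA0 : 0 ≤ A) (hA : ∀ j ζ, ‖aVec ψ j ζ‖ ≤ A)
    (x : (ℍ × ℍ × ℍ) × (EuclideanSpace ℝ (Fin 3) × EuclideanSpace ℝ (Fin 3))) :
    ‖NfunAt ξ ψ X hε x‖ ≤ (8 * A ^ 3 * (rotDensityConst hε)⁻¹) *
      ((rotWeight gTotal (RweightAt ξ hε) (Bweight hε) x).toReal *
        (‖X 0 (zetaVec x.1 x.2 0)‖ * ‖X 1 (zetaVec x.1 x.2 1)‖ * ‖X 2 (zetaVec x.1 x.2 2)‖)) := by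
  have hC := (rotDensityConst_pos hε).le
  have hrc0 := realCutAt_nonneg (ξ := ξ) hε x.1 x.2
  have hqd := qDensity_nonneg x.1
  have hslot : ∀ j v, ‖cdot (X j v) (projPerp v (aVec ψ j v))‖ ≤ ‖X j v‖ * (2 * A) := fun j v =>
    (norm_cdot_le _ _).trans (mul_le_mul_of_nonneg_left ((norm_projPerp_le _ _).trans (by linarith [hA j v]))
      (norm_nonneg _))
  have hh : ‖hProd ψ X (rotFreq x)‖ ≤ ‖X 0 (zetaVec x.1 x.2 0)‖ * (2 * A) * (‖X 1 (zetaVec x.1 x.2 1)‖ * (2 * A)) *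
      (‖X 2 (zetaVec x.1 x.2 2)‖ * (2 * A)) := by
    unfold hProd
    rw [rotFreq_eq, norm_mul, norm_mul]
    have := hslot 0 (zetaVec x.1 x.2 0)
    have := hslot 1 (zetaVec x.1 x.2 1)
    have := hslot 2 (zetaVec x.1 x.2 2)
    gcongr
  unfold NfunAt
  rw [norm_mul, Complex.norm_real, Real.norm_eq_abs, abs_of_nonneg (mul_nonneg hqd hrc0)]
  have hrl := realCutAt_le (ξ := ξ) hε x.1 x.2
  have hB0 : 0 ≤ qDensity x.1 * (qCut x.1 * pRadAt ξ hε x.2 * pFrame hε x.2 * (rotDensityConst hε)⁻¹) :=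
    mul_nonneg hqd (hrc0.trans hrl)
  calc _ ≤ qDensity x.1 * (qCut x.1 * pRadAt ξ hε x.2 * pFrame hε x.2 * (rotDensityConst hε)⁻¹) *
        (‖X 0 (zetaVec x.1 x.2 0)‖ * (2 * A) * (‖X 1 (zetaVec x.1 x.2 1)‖ * (2 * A)) * (‖X 2 (zetaVec x.1 x.2 2)‖ * (2 * A))) :=
        mul_le_mul (mul_le_mul_of_nonneg_left hrl hqd) hh (norm_nonneg _) hB0
    _ = (8 * A ^ 3 * (rotDensityConst hε)⁻¹) * ((qDensity x.1 * qCut x.1 * pRadAt ξ hε x.2 * pFrame hε x.2) *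
        (‖X 0 (zetaVec x.1 x.2 0)‖ * ‖X 1 (zetaVec x.1 x.2 1)‖ * ‖X 2 (zetaVec x.1 x.2 2)‖)) := by ring
    _ = _ := by rw [rotWeight_toReal_at (ξ := ξ) hε x]

/-- **The dominating function is integrable**: `∫ rotWeight ∏|Xⱼ(ζⱼ)| < ∞` by the disintegration
and `∏ⱼ ‖Xⱼ‖_{L¹} < ∞`. [cite: Tao2016AveragedNS, §3.6 p. 18] -/
theorem integrable_dominator_at (hε : 0 < ε₀) (hXm : ∀ j, Measurable (X j)) (hXi : ∀ j, Integrable (X j)) (K : ℝ) :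
    Integrable fun x : (ℍ × ℍ × ℍ) × (EuclideanSpace ℝ (Fin 3) × EuclideanSpace ℝ (Fin 3)) => K * ((rotWeight gTotal (RweightAt ξ hε) (Bweight hε) x).toReal *
      (‖X 0 (zetaVec x.1 x.2 0)‖ * ‖X 1 (zetaVec x.1 x.2 1)‖ * ‖X 2 (zetaVec x.1 x.2 2)‖)) := by
  refine Integrable.const_mul ?_ K
  have hmeas : Measurable fun x : (ℍ × ℍ × ℍ) × (EuclideanSpace ℝ (Fin 3) × EuclideanSpace ℝ (Fin 3)) => (rotWeight gTotal (RweightAt ξ hε) (Bweight hε) x).toReal *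
      (‖X 0 (zetaVec x.1 x.2 0)‖ * ‖X 1 (zetaVec x.1 x.2 1)‖ * ‖X 2 (zetaVec x.1 x.2 2)‖) :=
    (measurable_rotWeightAt (ξ := ξ) hε).ennreal_toReal.mul ((((hXm 0).comp (measurable_zetaVec 0)).norm.mul
      ((hXm 1).comp (measurable_zetaVec 1)).norm).mul ((hXm 2).comp (measurable_zetaVec 2)).norm)
  refine ⟨hmeas.aestronglyMeasurable, ?_⟩
  unfold HasFiniteIntegral
  have hpt : ∀ x : (ℍ × ℍ × ℍ) × (EuclideanSpace ℝ (Fin 3) × EuclideanSpace ℝ (Fin 3)), ‖(rotWeight gTotal (RweightAt ξ hε) (Bweight hε) x).toReal *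
      (‖X 0 (zetaVec x.1 x.2 0)‖ * ‖X 1 (zetaVec x.1 x.2 1)‖ * ‖X 2 (zetaVec x.1 x.2 2)‖)‖ₑ =
      rotWeight gTotal (RweightAt ξ hε) (Bweight hε) x *
        (‖X 0 (zetaVec x.1 x.2 0)‖ₑ * ‖X 1 (zetaVec x.1 x.2 1)‖ₑ * ‖X 2 (zetaVec x.1 x.2 2)‖ₑ) := by
    intro x
    rw [Real.enorm_eq_ofReal (mul_nonneg ENNReal.toReal_nonneg (by positivity)), ENNReal.ofReal_mul ENNReal.toReal_nonneg,
      ENNReal.ofReal_toReal (rotWeight_lt_top_at (ξ := ξ) hε x).ne, ENNReal.ofReal_mul (by positivity),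
      ENNReal.ofReal_mul (norm_nonneg _), ofReal_norm, ofReal_norm, ofReal_norm]
  simp_rw [hpt]
  have hle := lintegral_rotWeightAt_prod_le (ξ := ξ) hε (h := fun j v => ‖X j v‖ₑ) fun j => (hXm j).enorm
  refine lt_of_le_of_lt hle ?_
  refine ENNReal.mul_lt_top (rotDensityConstE_pos_lt_top hε).2 ?_
  exact ENNReal.mul_lt_top (hXi 0).2 (ENNReal.mul_lt_top (hXi 1).2 (hXi 2).2)

/-- **`G` is integrable on `Q × (EuclideanSpace ℝ (Fin 3))²`.** [cite: Tao2016AveragedNS, §3.6 p. 18] -/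
theorem integrable_GfunAt (hξ : IsFrameTriple ξ) (hε : 0 < ε₀) (hε1 : ε₀ ≤ 1 / 100) (hnd : NondegWithin ξ δ)
    (hδ : 5500 * ε₀ ^ 3 < δ) (hXm : ∀ j, Measurable (X j)) (hXi : ∀ j, Integrable (X j)) :
    Integrable (GfunAt ξ ψ X hε) := by
  obtain ⟨S, hS0, hS⟩ := exists_bound_Ssum_at (ψ := ψ) hnd hδ
  exact (integrable_dominator_at hε hXm hXi (5 * S * (rotDensityConst hε)⁻¹)).mono'
    (measurable_GfunAt hξ hε hε1 hnd hδ hXm).aestronglyMeasurable (ae_of_all _ (norm_GfunAt_le hξ hε hε1 hS0 hS))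

/-- **`N` is integrable on `Q × (EuclideanSpace ℝ (Fin 3))²`.** [cite: Tao2016AveragedNS, §3.6 p. 18] -/
theorem integrable_NfunAt (hε : 0 < ε₀) (hXm : ∀ j, Measurable (X j)) (hXi : ∀ j, Integrable (X j)) :
    Integrable (NfunAt ξ ψ X hε) := by
  obtain ⟨A, hA0, hA⟩ := exists_bound_aVec (ψ := ψ)
  exact (integrable_dominator_at hε hXm hXi (8 * A ^ 3 * (rotDensityConst hε)⁻¹)).mono'
    (measurable_NfunAt (ξ := ξ) hε hXm).aestronglyMeasurable (ae_of_all _ (norm_NfunAt_le (ξ := ξ) hε hA0 hA))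

/-- **The fibre step**: for `ξ` with integrable fibre, `∫ G(q, ξ) dq = ∫ N(q, ξ) dq` (torus average,
fibre identity, `w ≡ 1`). [cite: Tao2016AveragedNS, §3.6–3.9 pp. 18–20] -/
theorem fibre_step_at (hξ : IsFrameTriple ξ) (hε : 0 < ε₀) (hε1 : ε₀ ≤ 1 / 10000) (hnd : NondegWithin ξ δ)
    (hδ : 5500 * ε₀ ^ 3 < δ) (p : EuclideanSpace ℝ (Fin 3) × EuclideanSpace ℝ (Fin 3))
    (hint : Integrable fun q : ℍ × ℍ × ℍ => GfunAt ξ ψ X hε (q, p)) :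
    ∫ q, GfunAt ξ ψ X hε (q, p) = ∫ q, NfunAt ξ ψ X hε (q, p) := by
  have hε1' : ε₀ ≤ 1 / 100 := hε1.trans (by norm_num)
  by_cases hgood : pRadAt ξ hε p ≠ 0 ∧ pFrame hε p ≠ 0
  · have hg := goodFreq_of_cutoffs_at hξ hε hε1' hnd hδ hgood.1 hgood.2
    have hw : singleScaleWeightAtC ξ ε₀ p = 1 := singleScaleWeightAtC_eq_one_of_cutoffs hξ hε hε1 hgood.1 hgood.2
    rw [integral_eq_integral_torusAverage (norm_udir (hg.ne 0)) (norm_udir (hg.ne 1)) (norm_udir (hg.ne 2)) hint]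
    -- the torus integral of `G` at `q`
    have htor : ∀ q : ℍ × ℍ × ℍ, (∫ θ₃ in (0 : ℝ)..2 * π, ∫ θ₂ in (0 : ℝ)..2 * π, ∫ θ₁ in (0 : ℝ)..2 * π,
        GfunAt ξ ψ X hε (slotB (norm_quatExp (norm_udir (hg.ne 0)) θ₁)
          (slotC (norm_quatExp (norm_udir (hg.ne 1)) θ₂) (slotA (norm_quatExp (norm_udir (hg.ne 2)) θ₃) q)), p)) =
        ((qDensity q : ℝ) : ℂ) * ((2 * (π : ℂ)) ^ 3 * (((realCutAt ξ hε q p : ℝ) : ℂ) * hProd ψ X (rotFreq (q, p)))) := by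
      intro q
      have hpt : ∀ θ₁ θ₂ θ₃ : ℝ, GfunAt ξ ψ X hε (slotB (norm_quatExp (norm_udir (hg.ne 0)) θ₁)
          (slotC (norm_quatExp (norm_udir (hg.ne 1)) θ₂) (slotA (norm_quatExp (norm_udir (hg.ne 2)) θ₃) q)), p) =
          ((qDensity q : ℝ) : ℂ) * coreIntegrandAt ξ ψ X hε (slotB (norm_quatExp (norm_udir (hg.ne 0)) θ₁)
            (slotC (norm_quatExp (norm_udir (hg.ne 1)) θ₂) (slotA (norm_quatExp (norm_udir (hg.ne 2)) θ₃) q))) p := by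
        intro θ₁ θ₂ θ₃
        unfold GfunAt
        rw [qDensity_torus, hw, one_mul]
      have s1 := intervalIntegral.integral_congr (μ := volume) (a := (0 : ℝ)) (b := 2 * π) fun θ₃ _ =>
        intervalIntegral.integral_congr (μ := volume) (a := (0 : ℝ)) (b := 2 * π) fun θ₂ _ =>
          intervalIntegral.integral_congr (μ := volume) (a := (0 : ℝ)) (b := 2 * π) fun θ₁ _ => hpt θ₁ θ₂ θ₃
      rw [s1]
      simp only [intervalIntegral.integral_const_mul]
      rw [torus_integral_core_at hε hg q]
    simp_rw [htor]
    have e2 : ∀ q : ℍ × ℍ × ℍ, ((qDensity q : ℝ) : ℂ) * ((2 * (π : ℂ)) ^ 3 * (((realCutAt ξ hε q p : ℝ) : ℂ) *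
        hProd ψ X (rotFreq (q, p)))) = (2 * (π : ℂ)) ^ 3 * NfunAt ξ ψ X hε (q, p) := by
      intro q; unfold NfunAt; push_cast; ring
    simp_rw [e2]
    rw [MeasureTheory.integral_const_mul, Complex.real_smul]
    push_cast
    have hπ : (2 * (π : ℂ)) ≠ 0 := by
      have : (π : ℂ) ≠ 0 := Complex.ofReal_ne_zero.mpr Real.pi_ne_zero
      exact mul_ne_zero two_ne_zero this
    field_simp
  · -- the fibre is identically zero
    have hrc : ∀ q, realCutAt ξ hε q p = 0 := by
      intro q
      unfold realCutAt
      rcases not_and_or.mp hgood with h | h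
      · rw [not_ne_iff.mp h]; ring
      · rw [not_ne_iff.mp h]; ring
    have hG : ∀ q, GfunAt ξ ψ X hε (q, p) = 0 := by
      intro q; unfold GfunAt coreIntegrandAt FflatAt; rw [hrc q]; simp only [Complex.ofReal_zero, zero_mul, mul_zero]
    have hN : ∀ q, NfunAt ξ ψ X hε (q, p) = 0 := by
      intro q; unfold NfunAt; rw [hrc q]; simp only [mul_zero, Complex.ofReal_zero, zero_mul]
    simp_rw [hG, hN]

/-- `N(x) = rotWeight(x) • f(ζ(x))`. [cite: Tao2016AveragedNS, §3.6 p. 18] -/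
theorem NfunAt_eq_smul (hε : 0 < ε₀) (x : (ℍ × ℍ × ℍ) × (EuclideanSpace ℝ (Fin 3) × EuclideanSpace ℝ (Fin 3))) :
    NfunAt ξ ψ X hε x = (rotWeight gTotal (RweightAt ξ hε) (Bweight hε) x).toReal • fFunAt ξ ψ X hε (rotFreq x) := by
  unfold NfunAt fFunAt
  rw [rotWeight_toReal_at (ξ := ξ) hε x, Complex.real_smul, ← mul_assoc, ← zCutAt_eq_zCut3At ξ]
  congr 1
  unfold realCutAt
  push_cast
  ring

/-- **The disintegration step**: `∫ N = ∫ χ(ζ) ∏ⱼ Xⱼ(ζⱼ)·P aⱼ(ζⱼ) dζ`. [cite: Tao2016AveragedNS, §3.6 p. 18] -/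
theorem integral_NfunAt (hξ : IsFrameTriple ξ) (hε : 0 < ε₀) (hε1 : ε₀ ≤ 1 / 10) (hXm : ∀ j, Measurable (X j)) :
    ∫ x, NfunAt ξ ψ X hε x = ∫ ζ : EuclideanSpace ℝ (Fin 3) × EuclideanSpace ℝ (Fin 3) × EuclideanSpace ℝ (Fin 3), ((zCut3At ξ hε ζ : ℝ) : ℂ) * hProd ψ X ζ := by
  have hfm : Measurable (fFunAt ξ ψ X hε) := by
    unfold fFunAt
    exact (Complex.measurable_ofReal.comp (measurable_const.mul (continuous_zCut3At (ξ := ξ) hε).measurable)).mul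
      (measurable_hProd hXm)
  simp_rw [NfunAt_eq_smul (ξ := ξ) hε]
  rw [← integral_withDensity_eq_integral_toReal_smul₀ (measurable_rotWeightAt (ξ := ξ) hε).aemeasurable
    (ae_of_all _ (rotWeight_lt_top_at (ξ := ξ) hε)),
    ← integral_rotFreq_withDensity gTotal measurable_gTotal (RweightAt ξ hε) (measurable_RweightAt (ξ := ξ) hε) (Bweight hε)
      (measurable_Bweight hε) hfm.aestronglyMeasurable]
  rw [integral_withDensity_eq_integral_toReal_smul₀]
  · refine integral_congr_ae (ae_of_all _ fun ζ => ?_)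
    show (rotDensityConstE hε * triWeight (RweightAt ξ hε) ζ).toReal • fFunAt ξ ψ X hε ζ = _
    unfold fFunAt
    rw [Complex.real_smul, ← mul_assoc, ← Complex.ofReal_mul, density_mul_zCut3At hξ hε hε1]
  · exact (measurable_const.mul (measurable_triWeight (measurable_RweightAt (ξ := ξ) hε))).aemeasurable
  · refine ae_of_all _ fun ζ => ?_
    show rotDensityConstE hε * triWeight (RweightAt ξ hε) ζ < ⊤
    exact ENNReal.mul_lt_top (rotDensityConstE_pos_lt_top hε).2
      (lt_of_le_of_lt (triWeight_RweightAt_le_one (ξ := ξ) hε ζ) ENNReal.one_lt_top)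

/-- **The separated integral factorises.** [cite: Tao2016AveragedNS, §3.6 (3.15) p. 18] -/
theorem integral_zCut3At_hProd (hε : 0 < ε₀) :
    ∫ ζ : EuclideanSpace ℝ (Fin 3) × EuclideanSpace ℝ (Fin 3) × EuclideanSpace ℝ (Fin 3), ((zCut3At ξ hε ζ : ℝ) : ℂ) * hProd ψ X ζ =
      (∫ v, (((zetaBumpAt ξ hε 0) v : ℝ) : ℂ) * cdot (X 0 v) (projPerp v (aVec ψ 0 v))) *
        ((∫ v, (((zetaBumpAt ξ hε 1) v : ℝ) : ℂ) * cdot (X 1 v) (projPerp v (aVec ψ 1 v))) *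
          ∫ v, (((zetaBumpAt ξ hε 2) v : ℝ) : ℂ) * cdot (X 2 v) (projPerp v (aVec ψ 2 v))) := by
  set F : Fin 3 → EuclideanSpace ℝ (Fin 3) → ℂ := fun j v => (((zetaBumpAt ξ hε j) v : ℝ) : ℂ) * cdot (X j v) (projPerp v (aVec ψ j v)) with hF
  have e : ∀ ζ : EuclideanSpace ℝ (Fin 3) × EuclideanSpace ℝ (Fin 3) × EuclideanSpace ℝ (Fin 3), ((zCut3At ξ hε ζ : ℝ) : ℂ) * hProd ψ X ζ = F 0 ζ.1 * (F 1 ζ.2.1 * F 2 ζ.2.2) := by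
    intro ζ; simp only [hF, zCut3At, hProd]; push_cast; ring
  simp_rw [e]
  calc ∫ ζ : EuclideanSpace ℝ (Fin 3) × EuclideanSpace ℝ (Fin 3) × EuclideanSpace ℝ (Fin 3), F 0 ζ.1 * (F 1 ζ.2.1 * F 2 ζ.2.2)
      = ∫ ζ : EuclideanSpace ℝ (Fin 3) × EuclideanSpace ℝ (Fin 3) × EuclideanSpace ℝ (Fin 3), F 0 ζ.1 * (F 1 ζ.2.1 * F 2 ζ.2.2) ∂((volume : Measure (EuclideanSpace ℝ (Fin 3))).prod
          (volume : Measure (EuclideanSpace ℝ (Fin 3) × EuclideanSpace ℝ (Fin 3)))) := by rw [← Measure.volume_eq_prod]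
    _ = (∫ v, F 0 v) * ∫ w : EuclideanSpace ℝ (Fin 3) × EuclideanSpace ℝ (Fin 3), F 1 w.1 * F 2 w.2 := integral_prod_mul (F 0) (fun w : EuclideanSpace ℝ (Fin 3) × EuclideanSpace ℝ (Fin 3) => F 1 w.1 * F 2 w.2)
    _ = (∫ v, F 0 v) * ∫ w : EuclideanSpace ℝ (Fin 3) × EuclideanSpace ℝ (Fin 3), F 1 w.1 * F 2 w.2 ∂((volume : Measure (EuclideanSpace ℝ (Fin 3))).prod (volume : Measure (EuclideanSpace ℝ (Fin 3)))) := by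
        rw [← Measure.volume_eq_prod]
    _ = (∫ v, F 0 v) * ((∫ v, F 1 v) * ∫ v, F 2 v) := by rw [integral_prod_mul (F 1) (F 2)]

/-- **The main identity for measurable, integrable, divergence-free `Xⱼ`.** [cite: Tao2016AveragedNS, §3.5–3.9 (3.13), (3.15)–(3.16) pp. 17–20] -/
theorem jointWeightAverageW_eq_at (hξ : IsFrameTriple ξ) (hε : 0 < ε₀) (hε1 : ε₀ ≤ 1 / 10000) (hnd : NondegWithin ξ δ)
    (hδ : 5500 * ε₀ ^ 3 < δ)
    (hψ : NormalisedProfilesAt ξ ε₀ ψ) (hXm : ∀ j, Measurable (X j)) (hXi : ∀ j, Integrable (X j))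
    (hXd : ∀ j, FreqDivFree (X j)) :
    jointWeightAverageW jointMeasure jointE (singleScaleWeightAtC ξ ε₀) (jointFAt ξ ψ hε) (X 0) (X 1) (X 2) =
      (∫ ζ, cdot (X 0 ζ) (conj3 (𝓕 (⇑(ψ 0)) ζ))) * (∫ ζ, cdot (X 1 ζ) (conj3 (𝓕 (⇑(ψ 1)) ζ))) *
        ∫ ζ, cdot (X 2 ζ) (conj3 (𝓕 (⇑(ψ 2)) ζ)) := by
  have hε1' : ε₀ ≤ 1 / 100 := hε1.trans (by norm_num)
  have hε1'' : ε₀ ≤ 1 / 10 := hε1.trans (by norm_num)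
  have hG := integrable_GfunAt (ψ := ψ) hξ hε hε1' hnd hδ hXm hXi
  have hN := integrable_NfunAt (ψ := ψ) (ξ := ξ) hε hXm hXi
  -- Step 1: to the quaternion parameter space
  unfold jointWeightAverageW
  rw [integral_jointMeasure]
  have e1 : ∀ q : ℍ × ℍ × ℍ, qDensity q • (∫ p : EuclideanSpace ℝ (Fin 3) × EuclideanSpace ℝ (Fin 3), singleScaleWeightAtC ξ ε₀ p *
      jointFAt ξ ψ hε (quatTripleCLE.symm q, p) *
        Λ p.1 p.2 (rotMat (jointE 0 (quatTripleCLE.symm q)) (X 0 ((jointE 0 (quatTripleCLE.symm q)).symm p.1)))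
          (rotMat (jointE 1 (quatTripleCLE.symm q)) (X 1 ((jointE 1 (quatTripleCLE.symm q)).symm p.2)))
          (rotMat (jointE 2 (quatTripleCLE.symm q)) (X 2 ((jointE 2 (quatTripleCLE.symm q)).symm (-p.1 - p.2))))) =
      ∫ p : EuclideanSpace ℝ (Fin 3) × EuclideanSpace ℝ (Fin 3), GfunAt ξ ψ X hε (q, p) := by
    intro q
    have hqq : quatTripleEquiv (quatTripleCLE.symm q) = q := LinearEquiv.apply_symm_apply _ _
    rw [← MeasureTheory.integral_smul]
    refine integral_congr_ae (ae_of_all _ fun p => ?_)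
    dsimp only
    unfold GfunAt coreIntegrandAt Yrot jointFAt jointE
    rw [hqq, Complex.real_smul]
    simp only [slotQ_zero, slotQ_one, slotQ_two, freq3_zero, freq3_one, freq3_two]
    ring
  simp_rw [e1]
  -- Step 2: Fubini, fibre step, Fubini back
  have hG' : Integrable (GfunAt ξ ψ X hε) ((volume : Measure (ℍ × ℍ × ℍ)).prod (volume : Measure (EuclideanSpace ℝ (Fin 3) × EuclideanSpace ℝ (Fin 3)))) := hG
  have hN' : Integrable (NfunAt ξ ψ X hε) ((volume : Measure (ℍ × ℍ × ℍ)).prod (volume : Measure (EuclideanSpace ℝ (Fin 3) × EuclideanSpace ℝ (Fin 3)))) := hN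
  have e2 : ∫ q : ℍ × ℍ × ℍ, ∫ p : EuclideanSpace ℝ (Fin 3) × EuclideanSpace ℝ (Fin 3), GfunAt ξ ψ X hε (q, p) = ∫ p : EuclideanSpace ℝ (Fin 3) × EuclideanSpace ℝ (Fin 3), ∫ q : ℍ × ℍ × ℍ, GfunAt ξ ψ X hε (q, p) := by
    rw [← integral_prod _ hG', integral_prod_symm _ hG']
  rw [e2]
  have e3 : ∫ p : EuclideanSpace ℝ (Fin 3) × EuclideanSpace ℝ (Fin 3), ∫ q : ℍ × ℍ × ℍ, GfunAt ξ ψ X hε (q, p) = ∫ p : EuclideanSpace ℝ (Fin 3) × EuclideanSpace ℝ (Fin 3), ∫ q : ℍ × ℍ × ℍ, NfunAt ξ ψ X hε (q, p) := by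
    refine integral_congr_ae ?_
    filter_upwards [hG'.prod_left_ae] with p hp
    exact fibre_step_at hξ hε hε1 hnd hδ p hp
  rw [e3, ← integral_prod_symm _ hN']
  have e4 : ∫ x, NfunAt ξ ψ X hε x ∂((volume : Measure (ℍ × ℍ × ℍ)).prod (volume : Measure (EuclideanSpace ℝ (Fin 3) × EuclideanSpace ℝ (Fin 3)))) =
      ∫ x, NfunAt ξ ψ X hε x := rfl
  rw [e4]
  -- Step 3: disintegration and factorisation
  rw [integral_NfunAt hξ hε hε1'' hXm, integral_zCut3At_hProd (ξ := ξ) hε]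
  unfold aVec
  rw [slot_integral_eq_at hε (hψ 0) (hXd 0), slot_integral_eq_at hε (hψ 1) (hXd 1), slot_integral_eq_at hε (hψ 2) (hXd 2),
    mul_assoc]

/-! ### The discharge about a frame triple -/

/-- **Tao 2016, §3.6–3.9 about a frame triple: the rotation average with a smooth joint weight
reproduces the product of the profile pairings.** For a base triple `ξ` in frame position
(`IsFrameTriple`: sides in `[4/5, 3/2]`, Tao's plane, third direction and normal), `0 < ε₀ ≤ 10⁻⁴`,
the non-degeneracy (3.24) within a radius `δ > 5500 ε₀³` of `ξ` (`NondegWithin ξ δ`; for a base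
triple with input gap `≥ κ ε₀` this holds with `δ = min (1/100) (κ ε₀/4)`, `nondegWithin_of_gap`),
and profiles `ψⱼ` normalised about `ξ` (`ψ̂ⱼ ⊆ B̄(ξ j, ε₀³)`), the data `d = 4`, the quaternion
measure `jointMeasure`, the rotations `jointE` and the joint weight `jointFAt ξ ψ` satisfy, for all
frequency functions `X₁, X₂, X₃ ∈ L¹ ∩ L²` with `Xⱼ(ζ) ⊥ ζ` a.e.,
`jointWeightAverageW μ₀ E (φ η_ξ) F X₁ X₂ X₃ = ∏ⱼ ∫ Xⱼ · \overline{ψ̂ⱼ}` — the hypothesis of the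
§3.5–3.6 reduction `singleScaleAt_isComplexAverageNoDil_of_jointWeightAt`, i.e. the single-scale
step (3.9)/(3.13) of Theorem 3.2 WITHOUT dilation averaging about `ξ` (Remark 3.5: dilations were
only used to reach a base where (3.24) holds). [cite: Tao2016AveragedNS, §3.5–3.9 (3.13), (3.15)–(3.16), (3.20)–(3.24) pp. 17–20; Remark 3.5 p. 20] -/
theorem jointWeight_identity_frameTriple (hξ : IsFrameTriple ξ) (hε : 0 < ε₀) (hε1 : ε₀ ≤ 1 / 10000)
    (hnd : NondegWithin ξ δ) (hδ : 5500 * ε₀ ^ 3 < δ)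
    (ψ : Fin 3 → 𝓢(EuclideanSpace ℝ (Fin 3), EuclideanSpace ℂ (Fin 3))) (hψ : NormalisedProfilesAt ξ ε₀ ψ) :
    ∃ (d : ℕ) (μ₀ : Measure (Fin d → EuclideanSpace ℝ (Fin 3))), IsFiniteMeasure μ₀ ∧
      ∃ E : Fin 3 → (Fin d → EuclideanSpace ℝ (Fin 3)) → (EuclideanSpace ℝ (Fin 3) ≃ₗᵢ[ℝ] EuclideanSpace ℝ (Fin 3)),
        IsRotationFamily E ∧
        ∃ F : (Fin d → EuclideanSpace ℝ (Fin 3)) × (EuclideanSpace ℝ (Fin 3) × EuclideanSpace ℝ (Fin 3)) → ℂ,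
          ContDiff ℝ ((⊤ : ℕ∞) : WithTop ℕ∞) F ∧ HasCompactSupport F ∧
          ∀ X₁ X₂ X₃ : EuclideanSpace ℝ (Fin 3) → EuclideanSpace ℂ (Fin 3),
            FreqIntegrable X₁ → FreqIntegrable X₂ → FreqIntegrable X₃ →
            FreqDivFree X₁ → FreqDivFree X₂ → FreqDivFree X₃ →
              jointWeightAverageW μ₀ E (singleScaleWeightAtC ξ ε₀) F X₁ X₂ X₃ =
                (∫ ζ, cdot (X₁ ζ) (conj3 (𝓕 (⇑(ψ 0)) ζ))) * (∫ ζ, cdot (X₂ ζ) (conj3 (𝓕 (⇑(ψ 1)) ζ))) *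
                  ∫ ζ, cdot (X₃ ζ) (conj3 (𝓕 (⇑(ψ 2)) ζ)) := by
  have hε1' : ε₀ ≤ 1 / 100 := hε1.trans (by norm_num)
  refine ⟨4, jointMeasure, isFiniteMeasure_jointMeasure, jointE, isRotationFamily_jointE, jointFAt ξ ψ hε,
    contDiff_jointFAt hξ hε hε1' hnd hδ, hasCompactSupport_jointFAt hξ hε hε1', ?_⟩
  intro X₁ X₂ X₃ hi₁ hi₂ hi₃ hd₁ hd₂ hd₃
  -- strongly measurable representatives
  have hY₁ : X₁ =ᵐ[volume] hi₁.1.aestronglyMeasurable.mk X₁ := hi₁.1.aestronglyMeasurable.ae_eq_mk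
  have hY₂ : X₂ =ᵐ[volume] hi₂.1.aestronglyMeasurable.mk X₂ := hi₂.1.aestronglyMeasurable.ae_eq_mk
  have hY₃ : X₃ =ᵐ[volume] hi₃.1.aestronglyMeasurable.mk X₃ := hi₃.1.aestronglyMeasurable.ae_eq_mk
  rw [jointWeightAverageW_congr_ae jointMeasure jointE (singleScaleWeightAtC ξ ε₀) (jointFAt ξ ψ hε) hY₁ hY₂ hY₃,
    integral_cdot_congr_ae hY₁, integral_cdot_congr_ae hY₂, integral_cdot_congr_ae hY₃]
  set Y : Fin 3 → EuclideanSpace ℝ (Fin 3) → EuclideanSpace ℂ (Fin 3) := ![hi₁.1.aestronglyMeasurable.mk X₁,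
    hi₂.1.aestronglyMeasurable.mk X₂, hi₃.1.aestronglyMeasurable.mk X₃] with hYdef
  have hm : ∀ j, Measurable (Y j) := by
    intro j
    match j with
    | 0 => exact hi₁.1.aestronglyMeasurable.stronglyMeasurable_mk.measurable
    | 1 => exact hi₂.1.aestronglyMeasurable.stronglyMeasurable_mk.measurable
    | 2 => exact hi₃.1.aestronglyMeasurable.stronglyMeasurable_mk.measurable
  have hi : ∀ j, Integrable (Y j) := by
    intro j
    match j with
    | 0 => exact hi₁.1.congr hY₁
    | 1 => exact hi₂.1.congr hY₂
    | 2 => exact hi₃.1.congr hY₃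
  have hd : ∀ j, FreqDivFree (Y j) := by
    intro j
    match j with
    | 0 => exact hd₁.congr_ae hY₁
    | 1 => exact hd₂.congr_ae hY₂
    | 2 => exact hd₃.congr_ae hY₃
  exact jointWeightAverageW_eq_at (ψ := ψ) (X := Y) hξ hε hε1 hnd hδ hψ hm hi hd

end Literature.Analysis.FluidPDE.Tao2016
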